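import Literature.NumberTheory.LFunctions.ThetaChainFreeCheck
import HarnessLib

/-!
# Schoenfeld's `θ`-bound on `[599, 10⁸]` by kernel computation: data-free run, chunk 10 of 35

Topic: `Literature/NumberTheory/LFunctions`. Pure proof file (a kernel computation; nothing is
asserted, no definition). The theorems below evaluate `ThetaChain.runFree` — together `150000`
data-free steps of the certified `θ`-chain (`ThetaChain.stepFree`, `ThetaChainFreeCheck.lean`: the
next prime found and certified by two gcds with the primorials of the odd primes `≤ 2999` and in
`(2999, 10007]`, the enclosures of `log p` and `θ(p)`, and the two comparisons behind
`|θ(x) − x| ≤ √x log² x/(8π)`) — from the state at the prime `31509139` to the state at the prime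
`34104097`. Soundness: `ThetaChain.runFree_sound`; assembly of the 35 chunks: `ThetaUpTo1e8.lean`.
The expected states were obtained by evaluating a twin of the same function outside the kernel
(validated bit-for-bit on the tree's chunk `ThetaChainRun.xrun14`). Declarations of `5·10⁴` steps
(about `70 s` of kernel time each; the kernel's evaluation is linear within a declaration of this size),
`decide +kernel`, standard axioms only (`maxHeartbeats 0` lifts the deterministic time-out).

## References

* L. Schoenfeld, *Sharper bounds for the Chebyshev functions θ(x) and ψ(x). II*, Math. Comp. 30
  (1976), 337–360, Thm. 10 (6.3). [Schoenfeld1976]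
* J. B. Rosser, L. Schoenfeld, *Approximate formulas for some functions of prime numbers*,
  Illinois J. Math. 6 (1962), 64–94, Thms. 18–19 (`θ`-tables to `10⁸`). [RosserSchoenfeld1962]
-/

namespace Literature.NumberTheory.LFunctions.ThetaChainRun

open ThetaChain

set_option maxHeartbeats 0 in
/-- **Data-free certified `θ`-run, chunk 10a** (steps `1350001`–`1400000` after `8886113`: 50000 primes,
`31509139` to `32372177`). [cite: Schoenfeld1976, Thm. 10 (6.3)] -/
theorem frun10a :
    runFree 50000
      ⟨31509139, 20873057137318058689752092, 20873057137318534336688579, 38085074574694745116101921443816, 38085074574695670372988620573845⟩ =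
    some ⟨32372177, 20905724354319450256531786, 20905724354319925904433493, 39129547441894591072027234767253, 39129547441895540111284887094362⟩ := by
  decide +kernel

set_option maxHeartbeats 0 in
/-- **Data-free certified `θ`-run, chunk 10b** (steps `1400001`–`1450000` after `8886113`: 50000 primes,
`32372177` to `33237587`). [cite: Schoenfeld1976, Thm. 10 (6.3)] -/
theorem frun10b :
    runFree 50000
      ⟨32372177, 20905724354319450256531786, 20905724354319925904433493, 39129547441894591072027234767253, 39129547441895540111284887094362⟩ =
    some ⟨33237587, 20937618301522877329424194, 20937618301523352978289881, 40175633724351118582046160176622, 40175633724352091403723003994996⟩ := by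
  decide +kernel

set_option maxHeartbeats 0 in
/-- **Data-free certified `θ`-run, chunk 10c** (steps `1450001`–`1500000` after `8886113`: 50000 primes,
`33237587` to `34104097`). [cite: Schoenfeld1976, Thm. 10 (6.3)] -/
theorem frun10c :
    runFree 50000
      ⟨33237587, 20937618301522877329424194, 20937618301523352978289881, 40175633724351118582046160176622, 40175633724352091403723003994996⟩ =
    some ⟨34104097, 20968731397282554925710539, 20968731397283030575540136, 41223293759949028924713435132915, 41223293759950025528857656504554⟩ := by
  decide +kernel

end Literature.NumberTheory.LFunctions.ThetaChainRun
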